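import Literature.Computability.AlgebraicComplexity.InterfaceTensors
import Literature.Computability.AlgebraicComplexity.FlatteningRankCube
import HarnessLib

/-!
# Slot symmetry of the Coppersmith–Winograd tensor and of interface tensors
(Vassilevska Williams–Xu–Xu–Zhou 2024, §5.1: "the analysis for the other two regions follow by symmetry") — proved

Topic `Literature/Computability/AlgebraicComplexity`.  The global stage of Vassilevska Williams–Xu–Xu–Zhou
(SODA 2024, arXiv:2307.07970) treats three regions, sharing `Z`-, `Y`- and `X`-blocks respectively,
and analyses only the first: "we only give the detailed analysis on the first region as the analysis
for the other two regions follow by symmetry" (§5.1), "By symmetry, we can apply the same method to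
the second and third region, where for the second region we perform asymmetric hashing that shares
`Y`-variable blocks, and for the third region … `X`-blocks" (§5.7).  The symmetry in question is
the invariance of `CW_q` under permutations of its three slots together with the corresponding
renaming of the data of an interface tensor.  This file PROVES the dictionary:

* `bigCwTensor_swap₁₂`, `bigCwTensor_swap₁₃`, `bigCwTensor_swap₂₃` — `CW_q` is symmetric;
  `kroneckerPow_swap₁₃` etc. — so are its (chunked) powers;
* `InterfaceTerm.swapXZ` / `swapXY` / `swapYZ` — renaming the data of a term
  (`(i,j,k,γ_X,γ_Y,γ_Z) ↦ (k,j,i,γ_Z,γ_Y,γ_X)`, …);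
* `interfaceTensor_swapXZ` (and `XY`, `YZ`) — **the interface tensor of the renamed parameter list is
  the slot-swapped interface tensor**: `𝒯_{τ, L.swapXZ}(z, y, x) = 𝒯_{τ, L}(x, y, z)`;
* `tensorRestrictsTo_of_swap₁₃` (and `₁₂`, `₂₃`) — a restriction `(CW_q^{⊗c})^{⊗n} ≥ s` proved for
  renamed data yields `(CW_q^{⊗c})^{⊗n} ≥ (slot-swapped s)` for the original one
  (`TensorRestrictsTo.swap₁₃` of `AsymptoticSpectrumProofs.lean` and the invariance of the power).

Everything is proved; three definitions (the renamings); no named facts.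

## References

* V. Vassilevska Williams, Y. Xu, Z. Xu, R. Zhou, *New bounds for matrix multiplication: from alpha
  to omega*, SODA 2024, arXiv:2307.07970 (held: `paper:arxiv-2307.07970`), §5.1 and §5.7 (the three
  regions, "by symmetry"), §3.6 (`CW_q`). [VassilevskaWilliamsXuXuZhou2024]
-/

noncomputable section

open scoped BigOperators
open Finset

namespace Literature.Computability.AlgebraicComplexity

open Literature.Barriers.MatrixMultiplication (bigCwTensor bigCwTensor_apply)

universe u

/-! ## `CW_q` is symmetric in its three slots -/

section CwSymm

variable (K : Type u) [CommSemiring K] (q : ℕ)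

/-- `CW_q(b, a, c) = CW_q(a, b, c)`. [cite: VassilevskaWilliamsXuXuZhou2024, §3.6 (CW_q = Σ (x₀yᵢzᵢ + xᵢy₀zᵢ + xᵢyᵢz₀) + x₀y₀z_{q+1} + x₀y_{q+1}z₀ + x_{q+1}y₀z₀)] -/
theorem bigCwTensor_swap₁₂ (a b c : Fin (q + 2)) : bigCwTensor K q b a c = bigCwTensor K q a b c := by
  simp only [bigCwTensor_apply]
  congr 1
  apply propext
  constructor <;>
  · rintro (⟨h1, h2, h3, h4⟩ | ⟨h1, h2, h3, h4⟩ | ⟨h1, h2, h3, h4⟩ | ⟨h1, h2, h3⟩ | ⟨h1, h2, h3⟩ | ⟨h1, h2, h3⟩) <;>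
      subst_vars <;> simp_all

/-- `CW_q(c, b, a) = CW_q(a, b, c)`. [cite: VassilevskaWilliamsXuXuZhou2024, §3.6] -/
theorem bigCwTensor_swap₁₃ (a b c : Fin (q + 2)) : bigCwTensor K q c b a = bigCwTensor K q a b c := by
  simp only [bigCwTensor_apply]
  congr 1
  apply propext
  constructor <;>
  · rintro (⟨h1, h2, h3, h4⟩ | ⟨h1, h2, h3, h4⟩ | ⟨h1, h2, h3, h4⟩ | ⟨h1, h2, h3⟩ | ⟨h1, h2, h3⟩ | ⟨h1, h2, h3⟩) <;>
      subst_vars <;> simp_all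

/-- `CW_q(a, c, b) = CW_q(a, b, c)`. [cite: VassilevskaWilliamsXuXuZhou2024, §3.6] -/
theorem bigCwTensor_swap₂₃ (a b c : Fin (q + 2)) : bigCwTensor K q a c b = bigCwTensor K q a b c := by
  simp only [bigCwTensor_apply]
  congr 1
  apply propext
  constructor <;>
  · rintro (⟨h1, h2, h3, h4⟩ | ⟨h1, h2, h3, h4⟩ | ⟨h1, h2, h3, h4⟩ | ⟨h1, h2, h3⟩ | ⟨h1, h2, h3⟩ | ⟨h1, h2, h3⟩) <;>
      subst_vars <;> simp_all

variable {K q} {c n : ℕ}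

/-- The chunked power `(CW_q^{⊗c})^{⊗n}` is symmetric under swapping the first and third slots. [folklore] -/
theorem kroneckerPow_bigCw_swap₁₃ (x y z : Fin n → Fin c → Fin (q + 2)) :
    kroneckerPow (kroneckerPow (bigCwTensor K q) c) n z y x = kroneckerPow (kroneckerPow (bigCwTensor K q) c) n x y z := by
  simp only [kroneckerPow_apply, bigCwTensor_swap₁₃]

/-- … and under swapping the first two slots. [folklore] -/
theorem kroneckerPow_bigCw_swap₁₂ (x y z : Fin n → Fin c → Fin (q + 2)) :
    kroneckerPow (kroneckerPow (bigCwTensor K q) c) n y x z = kroneckerPow (kroneckerPow (bigCwTensor K q) c) n x y z := by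
  simp only [kroneckerPow_apply, bigCwTensor_swap₁₂]

/-- … and under swapping the last two slots. [folklore] -/
theorem kroneckerPow_bigCw_swap₂₃ (x y z : Fin n → Fin c → Fin (q + 2)) :
    kroneckerPow (kroneckerPow (bigCwTensor K q) c) n x z y = kroneckerPow (kroneckerPow (bigCwTensor K q) c) n x y z := by
  simp only [kroneckerPow_apply, bigCwTensor_swap₂₃]

end CwSymm

/-! ## Renaming the data of an interface tensor -/

namespace InterfaceTerm

variable {c : ℕ}

/-- Renaming `X ↔ Z`: `(i,j,k,γ_X,γ_Y,γ_Z) ↦ (k,j,i,γ_Z,γ_Y,γ_X)`. [cite: VassilevskaWilliamsXuXuZhou2024, §5.1 ("by symmetry")] -/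
def swapXZ (T : InterfaceTerm c) : InterfaceTerm c := ⟨T.k, T.j, T.i, T.γZ, T.γY, T.γX⟩

/-- Renaming `X ↔ Y`. [cite: VassilevskaWilliamsXuXuZhou2024, §5.1] -/
def swapXY (T : InterfaceTerm c) : InterfaceTerm c := ⟨T.j, T.i, T.k, T.γY, T.γX, T.γZ⟩

/-- Renaming `Y ↔ Z`. [cite: VassilevskaWilliamsXuXuZhou2024, §5.1] -/
def swapYZ (T : InterfaceTerm c) : InterfaceTerm c := ⟨T.i, T.k, T.j, T.γX, T.γZ, T.γY⟩

/-- Component of the renaming. [folklore] -/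
@[simp] theorem swapXZ_i (T : InterfaceTerm c) : T.swapXZ.i = T.k := rfl
/-- Component of the renaming. [folklore] -/
@[simp] theorem swapXZ_j (T : InterfaceTerm c) : T.swapXZ.j = T.j := rfl
/-- Component of the renaming. [folklore] -/
@[simp] theorem swapXZ_k (T : InterfaceTerm c) : T.swapXZ.k = T.i := rfl
/-- Component of the renaming. [folklore] -/
@[simp] theorem swapXZ_γX (T : InterfaceTerm c) : T.swapXZ.γX = T.γZ := rfl
/-- Component of the renaming. [folklore] -/
@[simp] theorem swapXZ_γY (T : InterfaceTerm c) : T.swapXZ.γY = T.γY := rfl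
/-- Component of the renaming. [folklore] -/
@[simp] theorem swapXZ_γZ (T : InterfaceTerm c) : T.swapXZ.γZ = T.γX := rfl
/-- Component of the renaming. [folklore] -/
@[simp] theorem swapXY_i (T : InterfaceTerm c) : T.swapXY.i = T.j := rfl
/-- Component of the renaming. [folklore] -/
@[simp] theorem swapXY_j (T : InterfaceTerm c) : T.swapXY.j = T.i := rfl
/-- Component of the renaming. [folklore] -/
@[simp] theorem swapXY_k (T : InterfaceTerm c) : T.swapXY.k = T.k := rfl
/-- Component of the renaming. [folklore] -/
@[simp] theorem swapXY_γX (T : InterfaceTerm c) : T.swapXY.γX = T.γY := rfl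
/-- Component of the renaming. [folklore] -/
@[simp] theorem swapXY_γY (T : InterfaceTerm c) : T.swapXY.γY = T.γX := rfl
/-- Component of the renaming. [folklore] -/
@[simp] theorem swapXY_γZ (T : InterfaceTerm c) : T.swapXY.γZ = T.γZ := rfl
/-- Component of the renaming. [folklore] -/
@[simp] theorem swapYZ_i (T : InterfaceTerm c) : T.swapYZ.i = T.i := rfl
/-- Component of the renaming. [folklore] -/
@[simp] theorem swapYZ_j (T : InterfaceTerm c) : T.swapYZ.j = T.k := rfl
/-- Component of the renaming. [folklore] -/
@[simp] theorem swapYZ_k (T : InterfaceTerm c) : T.swapYZ.k = T.j := rfl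
/-- Component of the renaming. [folklore] -/
@[simp] theorem swapYZ_γX (T : InterfaceTerm c) : T.swapYZ.γX = T.γX := rfl
/-- Component of the renaming. [folklore] -/
@[simp] theorem swapYZ_γY (T : InterfaceTerm c) : T.swapYZ.γY = T.γZ := rfl
/-- Component of the renaming. [folklore] -/
@[simp] theorem swapYZ_γZ (T : InterfaceTerm c) : T.swapYZ.γZ = T.γY := rfl

end InterfaceTerm

/-! ## The interface tensor of renamed data is the slot-swapped interface tensor -/

section Swap

variable (K : Type u) [CommSemiring K] (q : ℕ) {c n s : ℕ}

/-- **`𝒯_{τ, L.swapXZ}(z, y, x) = 𝒯_{τ, L}(x, y, z)`.** [cite: VassilevskaWilliamsXuXuZhou2024, §5.1 ("the analysis for the other two regions follow by symmetry")] -/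
theorem interfaceTensor_swapXZ (τ : Fin n → Fin s) (L : Fin s → InterfaceTerm c) (ε : ℝ)
    (x y z : Fin n → Fin c → Fin (q + 2)) :
    interfaceTensor K q τ (fun t => (L t).swapXZ) ε z y x = interfaceTensor K q τ L ε x y z := by
  simp only [interfaceTensor, partSubtensor_apply, levelBlocksX, levelBlocksY, levelBlocksZ,
    InterfaceTerm.swapXZ_i, InterfaceTerm.swapXZ_j, InterfaceTerm.swapXZ_k, InterfaceTerm.swapXZ_γX,
    InterfaceTerm.swapXZ_γY, InterfaceTerm.swapXZ_γZ, kroneckerPow_bigCw_swap₁₃]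
  congr 1
  apply propext
  tauto

/-- **`𝒯_{τ, L.swapXY}(y, x, z) = 𝒯_{τ, L}(x, y, z)`.** [cite: VassilevskaWilliamsXuXuZhou2024, §5.1] -/
theorem interfaceTensor_swapXY (τ : Fin n → Fin s) (L : Fin s → InterfaceTerm c) (ε : ℝ)
    (x y z : Fin n → Fin c → Fin (q + 2)) :
    interfaceTensor K q τ (fun t => (L t).swapXY) ε y x z = interfaceTensor K q τ L ε x y z := by
  simp only [interfaceTensor, partSubtensor_apply, levelBlocksX, levelBlocksY, levelBlocksZ,
    InterfaceTerm.swapXY_i, InterfaceTerm.swapXY_j, InterfaceTerm.swapXY_k, InterfaceTerm.swapXY_γX,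
    InterfaceTerm.swapXY_γY, InterfaceTerm.swapXY_γZ, kroneckerPow_bigCw_swap₁₂]
  congr 1
  apply propext
  tauto

/-- **`𝒯_{τ, L.swapYZ}(x, z, y) = 𝒯_{τ, L}(x, y, z)`.** [cite: VassilevskaWilliamsXuXuZhou2024, §5.1] -/
theorem interfaceTensor_swapYZ (τ : Fin n → Fin s) (L : Fin s → InterfaceTerm c) (ε : ℝ)
    (x y z : Fin n → Fin c → Fin (q + 2)) :
    interfaceTensor K q τ (fun t => (L t).swapYZ) ε x z y = interfaceTensor K q τ L ε x y z := by
  simp only [interfaceTensor, partSubtensor_apply, levelBlocksX, levelBlocksY, levelBlocksZ,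
    InterfaceTerm.swapYZ_i, InterfaceTerm.swapYZ_j, InterfaceTerm.swapYZ_k, InterfaceTerm.swapYZ_γX,
    InterfaceTerm.swapYZ_γY, InterfaceTerm.swapYZ_γZ, kroneckerPow_bigCw_swap₂₃]
  congr 1
  apply propext
  tauto

/-- `⟨k⟩` is symmetric in its three slots. [folklore] -/
theorem unitTensor_perm (k : ℕ) (a b d : Fin k) :
    unitTensor K k d b a = unitTensor K k a b d ∧ unitTensor K k b a d = unitTensor K k a b d ∧
      unitTensor K k a d b = unitTensor K k a b d := by
  simp only [unitTensor_apply]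
  refine ⟨?_, ?_, ?_⟩ <;>
  · by_cases h1 : a = b <;> by_cases h2 : b = d <;> subst_vars <;> simp_all [eq_comm]

/-- **Reading a restriction of the power back through the `X ↔ Z` symmetry**: if the power restricts to
`⟨k⟩ ⊗ 𝒯_{τ,L}`, it restricts to `⟨k⟩ ⊗ 𝒯_{τ,L.swapXZ}` (swap the first and third slots of both sides;
the power and `⟨k⟩` are symmetric). [cite: VassilevskaWilliamsXuXuZhou2024, §5.7 ("By symmetry, we can apply the same method to the second and third region")] -/
theorem tensorRestrictsTo_copies_swapXZ (τ : Fin n → Fin s) (L : Fin s → InterfaceTerm c) (ε : ℝ) (k : ℕ)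
    (h : TensorRestrictsTo (kroneckerPow (kroneckerPow (bigCwTensor K q) c) n)
      (kroneckerTensor (unitTensor K k) (interfaceTensor K q τ L ε))) :
    TensorRestrictsTo (kroneckerPow (kroneckerPow (bigCwTensor K q) c) n)
      (kroneckerTensor (unitTensor K k) (interfaceTensor K q τ (fun t => (L t).swapXZ) ε)) := by
  have h' : TensorRestrictsTo (fun u v w => kroneckerPow (kroneckerPow (bigCwTensor K q) c) n w v u)
      (fun u v w => kroneckerTensor (unitTensor K k) (interfaceTensor K q τ L ε) w v u) := h.swap₁₃.swap₂₃
  have e1 : (fun u v w => kroneckerPow (kroneckerPow (bigCwTensor K q) c) n w v u) =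
      kroneckerPow (kroneckerPow (bigCwTensor K q) c) n := by
    funext u v w
    exact kroneckerPow_bigCw_swap₁₃ u v w
  have e2 : (fun u v w => kroneckerTensor (unitTensor K k) (interfaceTensor K q τ L ε) w v u) =
      kroneckerTensor (unitTensor K k) (interfaceTensor K q τ (fun t => (L t).swapXZ) ε) := by
    funext u v w
    simp only [kroneckerTensor_apply]
    rw [(unitTensor_perm K k u.1 v.1 w.1).1, interfaceTensor_swapXZ]
  rw [e1, e2] at h'
  exact h'

/-- **Reading back through the `X ↔ Y` symmetry.** [cite: VassilevskaWilliamsXuXuZhou2024, §5.7] -/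
theorem tensorRestrictsTo_copies_swapXY (τ : Fin n → Fin s) (L : Fin s → InterfaceTerm c) (ε : ℝ) (k : ℕ)
    (h : TensorRestrictsTo (kroneckerPow (kroneckerPow (bigCwTensor K q) c) n)
      (kroneckerTensor (unitTensor K k) (interfaceTensor K q τ L ε))) :
    TensorRestrictsTo (kroneckerPow (kroneckerPow (bigCwTensor K q) c) n)
      (kroneckerTensor (unitTensor K k) (interfaceTensor K q τ (fun t => (L t).swapXY) ε)) := by
  have h' : TensorRestrictsTo (fun u v w => kroneckerPow (kroneckerPow (bigCwTensor K q) c) n v u w)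
      (fun u v w => kroneckerTensor (unitTensor K k) (interfaceTensor K q τ L ε) v u w) := h.swap₁₂
  have e1 : (fun u v w => kroneckerPow (kroneckerPow (bigCwTensor K q) c) n v u w) =
      kroneckerPow (kroneckerPow (bigCwTensor K q) c) n := by
    funext u v w
    exact kroneckerPow_bigCw_swap₁₂ u v w
  have e2 : (fun u v w => kroneckerTensor (unitTensor K k) (interfaceTensor K q τ L ε) v u w) =
      kroneckerTensor (unitTensor K k) (interfaceTensor K q τ (fun t => (L t).swapXY) ε) := by
    funext u v w
    simp only [kroneckerTensor_apply]
    rw [(unitTensor_perm K k u.1 v.1 w.1).2.1, interfaceTensor_swapXY]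
  rw [e1, e2] at h'
  exact h'

/-- **Reading back through the `Y ↔ Z` symmetry.** [cite: VassilevskaWilliamsXuXuZhou2024, §5.7] -/
theorem tensorRestrictsTo_copies_swapYZ (τ : Fin n → Fin s) (L : Fin s → InterfaceTerm c) (ε : ℝ) (k : ℕ)
    (h : TensorRestrictsTo (kroneckerPow (kroneckerPow (bigCwTensor K q) c) n)
      (kroneckerTensor (unitTensor K k) (interfaceTensor K q τ L ε))) :
    TensorRestrictsTo (kroneckerPow (kroneckerPow (bigCwTensor K q) c) n)
      (kroneckerTensor (unitTensor K k) (interfaceTensor K q τ (fun t => (L t).swapYZ) ε)) := by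
  have h' : TensorRestrictsTo (fun u v w => kroneckerPow (kroneckerPow (bigCwTensor K q) c) n u w v)
      (fun u v w => kroneckerTensor (unitTensor K k) (interfaceTensor K q τ L ε) u w v) := h.swap₂₃
  have e1 : (fun u v w => kroneckerPow (kroneckerPow (bigCwTensor K q) c) n u w v) =
      kroneckerPow (kroneckerPow (bigCwTensor K q) c) n := by
    funext u v w
    exact kroneckerPow_bigCw_swap₂₃ u v w
  have e2 : (fun u v w => kroneckerTensor (unitTensor K k) (interfaceTensor K q τ L ε) u w v) =
      kroneckerTensor (unitTensor K k) (interfaceTensor K q τ (fun t => (L t).swapYZ) ε) := by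
    funext u v w
    simp only [kroneckerTensor_apply]
    rw [(unitTensor_perm K k u.1 v.1 w.1).2.2, interfaceTensor_swapYZ]
  rw [e1, e2] at h'
  exact h'

end Swap

end Literature.Computability.AlgebraicComplexity
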